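import Literature.NumberTheory.EllipticCurves.KellerYin2024.AnticyclotomicLocalEulerFactorsConjugatePlaces
import Literature.NumberTheory.EllipticCurves.KellerYin2024.ResidualPairOuterConj
import Summits.BirchSwinnertonDyer.BirchSwinnertonDyer.Theorems.EisensteinPrimesGoodLatticeStableLineUnique
import HarnessLib

/-!
# The (eq:Euler-comp) symmetry `w ↔ w̄` for the good lattice: the three anticyclotomic local
# `λ`-invariants of crux 2's content stub agree at the two places above each `ℓ`

Cell `bsd-eis`, width seat `bsd-line-x1-p1-w2` gen 23, crux 2 `GoodLatticeBDPValue`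
(stmt-BirchSwinnertonDyer-19032), line `halves` v33N; helper `--supports`, closes no stub. PROVED, no
named fact, no `sorry`.

The CONTENT stub `stub_anacongOfFullDescentDatum := KellerYin2024.thm222_anacong_goodLattice_of_fullDescentDatum`
concludes `n + Σ_{w ∈ Sf} curveLocalLambda κ (W.baseChange K) w = 2·nφ + Σ_{w ∈ Sf} (charLocalLambda ∅ κ θsub w +
charLocalLambda ∅ κ θquot w)` over ALL places `w ∈ Sf` of `K` above `N_E`, whereas Castella–Grossi–Lee–Skinner's
Thm. 2.2.1 carries ONE place `w ∣ 𝔑` per `ℓ ∣ N` and the proof of Thm. 2.2.2 passes between the two by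
"complex conjugation acts as inversion on `Γ`" ((eq:Euler-comp), held text paper:arxiv-2008.02571 p. 12
L104–113).  This file assembles, AT THE BINDERS OF THE CONTENT STUB, the kernel form of that step from three
landed pieces: the Literature reading lemmas `KellerYin2024/AnticyclotomicLocalEulerFactorsConjugatePlaces`
(§2 `numPlacesAbove`, §3 `charLocalLambda` for a character fixed by the outer action, §4 `curveLocalLambda`)
and `KellerYin2024/ResidualPairOuterConj` (`IsResidualPairOver.outerConj`: the conjugate of a residual pair is a
residual pair), and width seat `-w2` gen 15's `…Theorems.GoodLatticeStableLineUnique.residualPair_unique_of_anom`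
(p740559: under `2 < p`, `Red`, `Anom`, (hlat), `K` imaginary quadratic with `p` split, the residual pair over `K`
is unique).  Results:

* §1 `residualPair_apply_absGaloisOuterConj`: under those hypotheses EVERY residual pair `(θsub, θquot)` of
  `E[p]` over `K` is FIXED by the outer action of `Γ_ℚ` (`θ (θ_τ σ) = θ σ`).
* §2 `charLocalLambda_residualPair_eq_of_natCast_mem`: hence, for `κ` anticyclotomic and two places
  `w, w' ∋ ℓ`, `charLocalLambda ∅ κ θsub w = charLocalLambda ∅ κ θsub w'` and the same for `θquot`.
* §3 `eulerComp_summand_eq_of_natCast_mem`: the full (eq:Euler-comp) summand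
  `charLocalLambda θsub + charLocalLambda θquot − curveLocalLambda (E/K)` (stated additively) agrees at `w`
  and `w'`, and so does each of its three terms.

HONEST FRAMING: helper lemmas on the tree's own objects; 0 stubs / cells / labels / tiers move; the by-name
surface of crux 2 is unchanged (`stub_printInputs` CITE ×5, `stub_anacongOfFullDescentDatum` CONTENT); an orphan
for -19032 until a CGLS-2.2.1-shaped typing of 3a-A (director key (β), -w2 g22 SIZING memo road (B)) consumes it.
No summit statement, no case of BSD, no crux or stub, no Keller–Yin / CGLS theorem is proved here.
References: [CastellaGrossiLeeSkinner2022] proof of Thm. 2.2.2 (eq:Euler-comp); [KellerYin2024] §1.4, Lemma 1.1.1,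
Thm. 2.2.2 (shape); [NeukirchANT1999] Ch. I §9.
-/

noncomputable section

open scoped Classical Pointwise

open NumberField IsDedekindDomain Field WeierstrassCurve
open Literature.NumberTheory.EllipticCurves Literature.NumberTheory.GaloisRepresentations
open Literature.NumberTheory.EllipticCurves.Rank1Residual
open Literature.NumberTheory.EllipticCurves.KellerYin2024

-- `Summit.BirchSwinnertonDyer.BirchSwinnertonDyer.…`: the summit and its single sub-problem share a name (D-0017 layout).
set_option linter.dupNamespace false

namespace Summit.BirchSwinnertonDyer.BirchSwinnertonDyer.Theorems.GoodLatticeAnacongEulerCompSymmetry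

variable {p : ℕ} [hp : Fact p.Prime] (W : WeierstrassCurve ℚ) [W.IsElliptic] [W.IsGloballyMinimal]
  (K : Type) [Field K] [NumberField K]

/-! ## §1 The residual pair of the good lattice over `K` is fixed by the outer action of `Γ_ℚ` -/

/-- **The residual pair `(θsub, θquot)` of the good lattice over `K` is fixed by the outer action of
`Γ_ℚ`**: for `W/ℚ` globally minimal, `2 < p`, `E[p]` reducible and anomalous (`Red`, `Anom`), every
rational `p`-line ramified at `p` ((hlat)), `K` imaginary quadratic with `p` split, any residual pair
over `K` and any `τ ∈ Γ_ℚ`: `θsub (θ_τ σ) = θsub σ` and `θquot (θ_τ σ) = θquot σ` — the conjugate pair is a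
residual pair (`IsResidualPairOver.outerConj`) and the residual pair is unique
(`GoodLatticeStableLineUnique.residualPair_unique_of_anom`). In print `φ, ψ` are `G_ℚ`-characters.
[cite: KellerYin2024, §1.4 display (char to f) (arXiv:2402.12781v2 TeX L1066–1081)]
[cite: CastellaGrossiLeeSkinner2022, Thm. 2.2.2 (φ, ψ as G_ℚ-characters)] -/
theorem residualPair_apply_absGaloisOuterConj [IsGalois ℚ K] (hp2 : 2 < p) (hred : Red W p)
    (hanom : Anom W p)
    (hlat : ∀ Φ : AddSubgroup (geomTorsion W (p : ℤ)), IsRationalLine W p Φ → ¬ LineUnramifiedAt W p Φ)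
    (hK : IsImaginaryQuadratic K) (hHp : SatisfiesHeegnerHypothesis p K)
    {S : Set (PadicAlgCl p)} {θsub θquot : FramedGaloisRep K (padicCoeffIntegers S) 1}
    (h : IsResidualPairOver (W.baseChange K) p θsub θquot) (τ : absoluteGaloisGroup ℚ)
    (σ : absoluteGaloisGroup K) :
    θsub (absGaloisOuterConj ℚ K τ σ) = θsub σ ∧ θquot (absGaloisOuterConj ℚ K τ σ) = θquot σ :=
  h.apply_absGaloisOuterConj_of_unique W (fun _ _ h' ↦
    GoodLatticeStableLineUnique.residualPair_unique_of_anom W K hp2 hred hanom hlat hK hHp h' h) τ σ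

/-! ## §2 `λ(𝒫_{w̄}(θ)) = λ(𝒫_w(θ))` for the residual characters -/

/-- **`charLocalLambda` of the residual characters is the same at two places above the same `ℓ`**
(`κ` anticyclotomic; hypotheses of §1): `KellerYin2024/AnticyclotomicLocalEulerFactorsConjugatePlaces` §3
with the outer-action invariance of §1. [cite: KellerYin2024, Lemma 1.1.1 (arXiv:2402.12781v2 TeX L455–462)]
[cite: CastellaGrossiLeeSkinner2022, proof of Thm. 2.2.2 (eq:Euler-comp)] -/
theorem charLocalLambda_residualPair_eq_of_natCast_mem (hp2 : 2 < p) (hred : Red W p)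
    (hanom : Anom W p)
    (hlat : ∀ Φ : AddSubgroup (geomTorsion W (p : ℤ)), IsRationalLine W p Φ → ¬ LineUnramifiedAt W p Φ)
    (hK : IsImaginaryQuadratic K) (hHp : SatisfiesHeegnerHypothesis p K)
    {κ : ZpExtension K p} (hκ : κ.IsAnticyclotomic)
    {S : Set (PadicAlgCl p)} {θsub θquot : FramedGaloisRep K (padicCoeffIntegers S) 1}
    (h : IsResidualPairOver (W.baseChange K) p θsub θquot) {ℓ : ℕ} (hℓ : ℓ.Prime)
    {w w' : HeightOneSpectrum (𝓞 K)} (hw : ((ℓ : ℕ) : 𝓞 K) ∈ w.asIdeal)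
    (hw' : ((ℓ : ℕ) : 𝓞 K) ∈ w'.asIdeal) :
    charLocalLambda S κ θsub w = charLocalLambda S κ θsub w' ∧
      charLocalLambda S κ θquot w = charLocalLambda S κ θquot w' := by
  haveI : Algebra.IsQuadraticExtension ℚ K := ⟨hK.1⟩
  have hfix := residualPair_apply_absGaloisOuterConj W K hp2 hred hanom hlat hK hHp h
  exact ⟨hκ.charLocalLambda_eq_of_natCast_mem S θsub (fun τ σ ↦ (hfix τ σ).1) hℓ hw hw',
    hκ.charLocalLambda_eq_of_natCast_mem S θquot (fun τ σ ↦ (hfix τ σ).2) hℓ hw hw'⟩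

/-! ## §3 The (eq:Euler-comp) summand at `w` and `w̄` -/

/-- **The (eq:Euler-comp) summand `λ(𝒫_w(θsub)) + λ(𝒫_w(θquot))` vs `λ(𝒫_w(f_E))` is symmetric in
`w ↔ w̄`**: under the hypotheses of §1, for `κ` anticyclotomic and two places `w, w' ∋ ℓ` of `K`, all
three local invariants of the content stub's conclusion agree at `w` and `w'`:
`numPlacesAbove κ w = numPlacesAbove κ w'`, `curveLocalLambda κ (W.baseChange K) w = … w'`,
`charLocalLambda S κ θsub w = … w'`, `charLocalLambda S κ θquot w = … w'` — the kernel form of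
"λ(𝒫_w(θ)²) = λ(𝒫_w(θ)) + λ(𝒫_{w̄}(θ)) … where `w` runs over all divisors, not just the one dividing `𝔑`"
(CGLS, proof of Thm. 2.2.2). [cite: CastellaGrossiLeeSkinner2022, proof of Thm. 2.2.2 (eq:Euler-comp) (held text paper:arxiv-2008.02571 p. 12 L104–113)]
[cite: KellerYin2024, Lemma 1.1.1 and §1.5 (arXiv:2402.12781v2 TeX L455–462, L1337–1341)] -/
theorem eulerComp_local_eq_of_natCast_mem (hp2 : 2 < p) (hred : Red W p) (hanom : Anom W p)
    (hlat : ∀ Φ : AddSubgroup (geomTorsion W (p : ℤ)), IsRationalLine W p Φ → ¬ LineUnramifiedAt W p Φ)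
    (hK : IsImaginaryQuadratic K) (hHp : SatisfiesHeegnerHypothesis p K)
    {κ : ZpExtension K p} (hκ : κ.IsAnticyclotomic)
    {S : Set (PadicAlgCl p)} {θsub θquot : FramedGaloisRep K (padicCoeffIntegers S) 1}
    (h : IsResidualPairOver (W.baseChange K) p θsub θquot) {ℓ : ℕ} (hℓ : ℓ.Prime)
    {w w' : HeightOneSpectrum (𝓞 K)} (hw : ((ℓ : ℕ) : 𝓞 K) ∈ w.asIdeal)
    (hw' : ((ℓ : ℕ) : 𝓞 K) ∈ w'.asIdeal) :
    numPlacesAbove κ w = numPlacesAbove κ w' ∧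
      curveLocalLambda κ (W.baseChange K) w = curveLocalLambda κ (W.baseChange K) w' ∧
      charLocalLambda S κ θsub w = charLocalLambda S κ θsub w' ∧
      charLocalLambda S κ θquot w = charLocalLambda S κ θquot w' := by
  have hc := charLocalLambda_residualPair_eq_of_natCast_mem W K hp2 hred hanom hlat hK hHp hκ h hℓ hw hw'
  exact ⟨hκ.numPlacesAbove_eq_of_natCast_mem_of_finrank_eq_two hK.1 hℓ hw hw',
    hκ.curveLocalLambda_baseChange_eq_of_natCast_mem W hK.1 hℓ hw hw', hc.1, hc.2⟩

/-- **The (eq:Euler-comp) summand is symmetric**, additive form: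
`charLocalLambda θsub w + charLocalLambda θquot w + curveLocalLambda w' =
charLocalLambda θsub w' + charLocalLambda θquot w' + curveLocalLambda w` (so the `ℕ`-difference
`λ(𝒫_w(θsub)) + λ(𝒫_w(θquot)) − λ(𝒫_w(f_E))` is the same at `w` and `w'` without truncated subtraction).
[cite: CastellaGrossiLeeSkinner2022, proof of Thm. 2.2.2 (eq:Euler-comp)] -/
theorem eulerComp_summand_eq_of_natCast_mem (hp2 : 2 < p) (hred : Red W p) (hanom : Anom W p)
    (hlat : ∀ Φ : AddSubgroup (geomTorsion W (p : ℤ)), IsRationalLine W p Φ → ¬ LineUnramifiedAt W p Φ)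
    (hK : IsImaginaryQuadratic K) (hHp : SatisfiesHeegnerHypothesis p K)
    {κ : ZpExtension K p} (hκ : κ.IsAnticyclotomic)
    {S : Set (PadicAlgCl p)} {θsub θquot : FramedGaloisRep K (padicCoeffIntegers S) 1}
    (h : IsResidualPairOver (W.baseChange K) p θsub θquot) {ℓ : ℕ} (hℓ : ℓ.Prime)
    {w w' : HeightOneSpectrum (𝓞 K)} (hw : ((ℓ : ℕ) : 𝓞 K) ∈ w.asIdeal)
    (hw' : ((ℓ : ℕ) : 𝓞 K) ∈ w'.asIdeal) :
    charLocalLambda S κ θsub w + charLocalLambda S κ θquot w + curveLocalLambda κ (W.baseChange K) w' =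
      charLocalLambda S κ θsub w' + charLocalLambda S κ θquot w' +
        curveLocalLambda κ (W.baseChange K) w := by
  obtain ⟨-, hE, hs, hq⟩ :=
    eulerComp_local_eq_of_natCast_mem W K hp2 hred hanom hlat hK hHp hκ h hℓ hw hw'
  rw [hE, hs, hq]

end Summit.BirchSwinnertonDyer.BirchSwinnertonDyer.Theorems.GoodLatticeAnacongEulerCompSymmetry

end
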